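import Literature.NumberTheory.LFunctions.SuzukiWeilKernelExpansionProofs
import Literature.NumberTheory.LFunctions.SuzukiWeilChainBoundaryProofs
import HarnessLib

/-!
# CJM Prop. 4.1: `{F_γ}_{γ∈Γ}` is an orthonormal basis of `𝒦(Θ_ξ)` — discharge of `Suzuki2025_prop41`

LINE 1 — LABEL: RH-CONSEQUENCE proof (explicit binder `RiemannHypothesis →`, never dropped) of a
printed «Assume RH» statement of the cell rh-crit/dbl (M. Suzuki, *On the Hilbert space derived from
the Weil distribution*, Canad. J. Math. 2025 = arXiv:2301.00421v3, Prop. 4.1). bears_on: B-C/B-P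
(LADDER-RH COLUMN 6 DBR). WHAT THIS IS NOT: a printed consequence of RH formalised as such; it does not
move RH; nothing here bears on the truth of RH.

## What is proved

`Suzuki2025_prop41_holds : Suzuki2025_prop41` (the typed CJM Prop. 4.1 of
`SuzukiScrewLine.lean`). Its limit clauses (4.1)–(4.2) are the cell's RH-free theorems
`Suzuki2025_prop41_eq41` / `Suzuki2025_prop41_eq42`; the remaining conjunct — under RH the classes
of `F_γ|_ℝ` are ORTHONORMAL in `L²(ℝ)` and their closed span IS the boundary-value model space
`modelSpaceL2 Θ_ξ` — is assembled here from landed material: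
* `F_γ|_ℝ = 𝖥ψ_γ` a.e. for the family `ψ_γ ∈ V(0)` of `exists_suzukiFamily`
  (`suzukiFourierL2_ae_eq_screwBasis`: the boundary identity `Φ/E_ξ = 𝖥ψ` a.e. of
  `div_lagariasE_ae_eq_suzukiFourierL2` applied to `Φ = E_ξ·G_γ`, `G_γ` the continuation of `F_γ`);
* orthonormality: `orthonormal_suzukiFourierL2_family`;
* `closure span{F_γ} ⊆ 𝒦(Θ)`: `𝒦(Θ) = 𝖥(V(0))` (`suzukiFourierL2_image_suzukiV_zero`) is closed;
* `𝒦(Θ) ⊆ closure span{F_γ}`: for `F = 𝖥ψ ∈ 𝒦(Θ)` the difference `F − P_W F` is `𝖥ψ′` with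
  `ψ′ ∈ V(0)` orthogonal to every `ψ_γ`, hence `0` by COMPLETENESS
  (`eq_zero_of_forall_inner_family_eq_zero`, the kernel-expansion theorem of the cell).
No definition and no named fact is introduced.

## References
* M. Suzuki, Canad. J. Math. 2025 = arXiv:2301.00421v3, Prop. 4.1 p. 10 (TeX l.1120–1142), §2.4
  p. 5 (TeX l.686–705). [Suzuki2025WeilHilbertSpace]
* M. Suzuki, J. Number Theory 252 (2023), Prop. 3.2 (the printed source of Prop. 4.1). [Suzuki2023b]
-/

noncomputable section

open MeasureTheory Complex Filter Set FourierTransform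
open scoped ComplexConjugate FourierTransform Topology Real ENNReal InnerProductSpace

namespace Literature.NumberTheory.LFunctions

open ZetaZeros Literature.Analysis.DeBrangesSpaces SuzukiOrthogonalSet

/-- **`𝖥ψ = F_γ` a.e. on `ℝ` (under RH)** for `ψ ∈ V(0)` whose half-plane transform is `F_γ` on
`ℂ₊`: the boundary identity `Φ/E_ξ = 𝖥ψ` a.e. for `Φ := E_ξ·G_γ` (`G_γ` the continuation of `F_γ`
to the closed upper half-plane), and `G_γ = F_γ` a.e. on `ℝ`. RH-CONSEQUENCE.
[cite: Suzuki2025WeilHilbertSpace, CJM eq. (5.11) p. 15 ("F_γ = ψ̂_γ") and eq. (3.5) p. 9] -/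
theorem suzukiFourierL2_ae_eq_screwBasis (hRH : RiemannHypothesis) {ρ : ℂ}
    (hρ : ρ ∈ riemannZetaNontrivialZeros) {ψ : Lp ℂ 2 (volume : Measure ℝ)} (hψ : ψ ∈ suzukiV 0)
    (hhat : ∀ w : ℂ, 0 < w.im → upperHalfHat ψ w = screwBasis ρ w) :
    (suzukiFourierL2 ψ : ℝ → ℂ) =ᵐ[volume] fun x : ℝ ↦ screwBasis ρ x := by
  obtain ⟨G, hGd, hGeq⟩ := exists_continuation hRH hρ
  have hψ0 : ψ ∈ halfLineL2 0 := (mem_suzukiV_iff.1 hψ).1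
  have hΦc : ∀ x : ℝ, ContinuousAt (fun z : ℂ ↦ lagariasE z * G z) x := fun x ↦
    continuous_lagariasE.continuousAt.mul
      (hGd x (by rw [Complex.ofReal_im])).continuousAt
  have hΦ : ∀ z : ℂ, 0 < z.im → lagariasE z * G z = lagariasE z * upperHalfHat ψ z := by
    intro z hz
    rw [hhat z hz, continuation_eq_screwBasis hρ hGeq (lagariasE_ne_zero_of_im_pos hRH hz) ?_]
    rintro rfl
    exact hz.ne' (suzukiZeroParam_im_eq_zero hRH hρ)
  have h := div_lagariasE_ae_eq_suzukiFourierL2 hψ0 hΦc hΦ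
  filter_upwards [h, continuation_ae_eq_screwBasis hρ hGeq,
    ae_lagariasE_ne_zero_and_ne (suzukiZeroParam ρ)] with x h1 h2 h3
  rw [← h1, mul_div_cancel_left₀ _ h3.1, h2]

/-- `𝒦(Θ_ξ)` (the boundary-value model space `modelSpaceL2 Θ_ξ`) is closed in `L²(ℝ)`: it is
`H² ∩ ⋂_{G ∈ H²} {F | ⟪Θ·G, F⟫ = 0}`. [folklore] -/
private theorem isClosed_modelSpaceL2_aux : IsClosed (modelSpaceL2 lagariasTheta) := by
  have h1 : IsClosed (hardyL2 : Set (Lp ℂ 2 (volume : Measure ℝ))) := by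
    have := Submodule.isClosed_topologicalClosure hardyL2Submodule
    rwa [hardyL2Submodule_topologicalClosure] at this
  have h2 : modelSpaceL2 lagariasTheta =
      hardyL2 ∩ ⋂ G ∈ hardyL2, {F | inner ℂ (thetaMul G) F = 0} := by
    ext F
    simp only [modelSpaceL2, Set.mem_setOf_eq, Set.mem_inter_iff, Set.mem_iInter, inner_thetaMul]
  rw [h2]
  exact h1.inter (isClosed_biInter fun G _ ↦
    isClosed_eq (continuous_const.inner continuous_id) continuous_const)

/-- **Discharge of `Suzuki2025_prop41` (CJM Prop. 4.1): under RH, `{F_γ}_{γ∈Γ}` is an orthonormal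
basis of `𝒦(Θ_ξ)`, with (4.1) `Θ′(γ)/2 = −i/m_γ` and the values (4.2).** The classes of `F_γ|_ℝ` are
the `𝖥ψ_γ` of the cell's family; orthonormality and COMPLETENESS are the cell's
`orthonormal_suzukiFourierL2_family` / `eq_zero_of_forall_inner_family_eq_zero` (kernel expansion
via the Hadamard partial fraction — the content of de Branges' Thm. 22 in the printed proof),
transported through `𝒦(Θ) = 𝖥(V(0))`; the limits are `Suzuki2025_prop41_eq41/eq42`.
RH-CONSEQUENCE, PROVED.
[cite: Suzuki2025WeilHilbertSpace, CJM Prop. 4.1 p. 10 (TeX l.1120–1142); Suzuki2023b, Prop. 3.2 p. 8] -/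
theorem Suzuki2025_prop41_holds : Suzuki2025_prop41 := by
  intro hRH
  refine ⟨?_, Suzuki2025_prop41_eq41, Suzuki2025_prop41_eq42⟩
  classical
  obtain ⟨ψb, hV, -, -, hnorm, horth, hhat⟩ := exists_suzukiFamily hRH
  have hF : ∀ ρ : riemannZetaNontrivialZeros, MemLp (fun x : ℝ ↦ screwBasis ρ x) 2 volume :=
    fun ρ ↦ memLp_two_screwBasis ρ.2
  refine ⟨hF, ?_⟩
  -- the classes of `F_γ|_ℝ` are the `𝖥ψ_γ`
  set f : riemannZetaNontrivialZeros → Lp ℂ 2 (volume : Measure ℝ) :=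
    fun ρ ↦ suzukiFourierL2 (ψb ρ) with hf
  have hFf : (fun ρ : riemannZetaNontrivialZeros ↦
      ((hF ρ).toLp _ : Lp ℂ 2 (volume : Measure ℝ))) = f := by
    funext ρ
    exact Lp.ext ((MemLp.coeFn_toLp _).trans
      (suzukiFourierL2_ae_eq_screwBasis hRH ρ.2 (hV ρ ρ.2) (hhat ρ ρ.2)).symm)
  rw [hFf]
  refine ⟨orthonormal_suzukiFourierL2_family hnorm horth, ?_⟩
  -- `W := closure span{f_γ}`, `M := 𝖥(V(0)) = 𝒦(Θ)` as submodules of `L²(ℝ)`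
  set W : Submodule ℂ (Lp ℂ 2 (volume : Measure ℝ)) :=
    (Submodule.span ℂ (Set.range f)).topologicalClosure with hW
  haveI : CompleteSpace W := (Submodule.isClosed_topologicalClosure _).completeSpace_coe
  set L : Lp ℂ 2 (volume : Measure ℝ) →L[ℂ] Lp ℂ 2 (volume : Measure ℝ) := suzukiFourierL2CLM
    with hL
  have hLapply : ∀ ψ, L ψ = suzukiFourierL2 ψ := fun ψ ↦ rfl
  set M : Submodule ℂ (Lp ℂ 2 (volume : Measure ℝ)) :=
    (suzukiVSubmodule 0).map (L : Lp ℂ 2 (volume : Measure ℝ) →ₗ[ℂ] Lp ℂ 2 (volume : Measure ℝ))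
    with hM
  have hMcoe : (M : Set (Lp ℂ 2 (volume : Measure ℝ))) = modelSpaceL2 lagariasTheta := by
    rw [hM, Submodule.map_coe, ← suzukiFourierL2_image_suzukiV_zero]
    rfl
  have hMc : IsClosed (M : Set (Lp ℂ 2 (volume : Measure ℝ))) := by
    rw [hMcoe]; exact isClosed_modelSpaceL2_aux
  have hfM : ∀ ρ, f ρ ∈ M := fun ρ ↦ by
    rw [hM, Submodule.mem_map]
    exact ⟨ψb ρ, hV ρ ρ.2, rfl⟩
  have hfW : ∀ ρ, f ρ ∈ W := fun ρ ↦
    (Submodule.span ℂ (Set.range f)).le_topologicalClosure (Submodule.subset_span ⟨ρ, rfl⟩)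
  have hWM : W ≤ M :=
    Submodule.topologicalClosure_minimal _ (Submodule.span_le.2 (by
      rintro _ ⟨ρ, rfl⟩; exact hfM ρ)) hMc
  suffices hMW : M = W by rw [← hMcoe, hMW]
  refine le_antisymm ?_ hWM
  intro F hFM
  obtain ⟨ψ, hψ, rfl⟩ := Submodule.mem_map.1 hFM
  -- `D := 𝖥ψ − P_W 𝖥ψ ∈ M ∩ Wᗮ` is `𝖥ψ′` with `ψ′ ∈ V(0)` orthogonal to every `ψ_γ`, hence `0`
  have hD1 : (L : _ →ₗ[ℂ] _) ψ - W.starProjection ((L : _ →ₗ[ℂ] _) ψ) ∈ Wᗮ :=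
    Submodule.sub_starProjection_mem_orthogonal _
  have hD2 : (L : _ →ₗ[ℂ] _) ψ - W.starProjection ((L : _ →ₗ[ℂ] _) ψ) ∈ M :=
    M.sub_mem hFM (hWM (Submodule.starProjection_apply_mem W _))
  obtain ⟨ψ', hψ', hψ'eq⟩ := Submodule.mem_map.1 hD2
  have h0 : ∀ ρ ∈ riemannZetaNontrivialZeros, inner ℂ (ψb ρ) ψ' = 0 := by
    intro ρ hρ
    have h := Submodule.inner_right_of_mem_orthogonal (K := W) (hfW ⟨ρ, hρ⟩) hD1
    rw [← hψ'eq] at h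
    change inner ℂ (suzukiFourierL2 (ψb ρ)) (suzukiFourierL2 ψ') = 0 at h
    rw [inner_suzukiFourierL2] at h
    exact (mul_eq_zero.1 h).resolve_left (by exact_mod_cast Real.two_pi_pos.ne')
  have hψ'0 : ψ' = 0 := eq_zero_of_forall_inner_family_eq_zero hRH hV hnorm horth hhat hψ' h0
  have hD0 : (L : _ →ₗ[ℂ] _) ψ - W.starProjection ((L : _ →ₗ[ℂ] _) ψ) = 0 := by
    rw [← hψ'eq, hψ'0, map_zero]
  rw [sub_eq_zero] at hD0
  rw [hD0]
  exact Submodule.starProjection_apply_mem W _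

end Literature.NumberTheory.LFunctions

end
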